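import Summits.BirchSwinnertonDyer.BirchSwinnertonDyer.Theorems.SignedLowerHalvesSmallImageLowerHalfBothSignsRttD2SeqGlueSocket
import HarnessLib

/-!
# Route `SignedLowerHalves`, crux L `SmallImageLowerHalfBothSigns` (stmt-BirchSwinnertonDyer-23599), line `rtt_w3` v13 — E2, rows (1′)/(6′) junction:
# THE JUNCTION SOCKET on the Pontryagin side of row (J3) — `j : B → ker gX` from a pairing with RECIPROCITY, `Λ_𝒪`-linear under the intertwining laws,
# ONTO under the Poitou–Tate annihilator identity

WIDTH seat `bsd-line-slh-p3-w3` g20 under LEAD `cruxlead-stmt-BirchSwinnertonDyer-23599` g10 (cell `bsd-ssimc`); LEAD g10 INPUT SPEC «junction, Galois side» (bus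
2026-08-30T16:25:56Z) row (J3): «`H` (:= `ker gX` of -w3 g20's `gXLinearMap`), `j : B →ₗ[Λ_𝒪] H` SURJECTIVE (π∘loc_v; Poitou–Tate …)». Sequel of `…RttD2SeqGlueSocket`
(parts 1–4: `locSat`, `LocalCondDualData`, `gXHom`/`gXLinearMapO`, `gXHom_eq_zero_iff`). THEOREMS ONLY (no definition, no named fact, no `sorry`): the Galois inputs —
the pairing-induced map `P` (local Tate duality at the tower), RECIPROCITY, the ANNIHILATOR IDENTITY (Poitou–Tate) — are HYPOTHESES; crux L, crux M, E2 and BSD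
remain OPEN and are proved for NO curve by any of this.
* `exists_junctionHom`: for any abelian group `B` and additive `P : B → Hom(E^{ε}_{sat,v}, ℚ/ℤ)` with `P b (loc_v s) = 0` (reciprocity), there is `j : B →+ ker gX` with
  `DQ.toDual ∘ j = P`; `junctionHom_unique`; `junctionHom_surjective_of_annihilator` (every character killing `loc_v(Sel)` is a `P b` ⟹ `j` onto).
* `pairing_map_iwasawaToIwasawaO_smul` / `pairing_map_smul_eq`: under `P (T • b) = P b ∘ (conj_{γ_v} − 1)` and `P ((C a) • b) = P b ∘ (a ·)` (equivariance of the
  pairing in the dual convention of `LocalCondDualData`, `𝒪`-bilinearity) the pairing map is `Λ_𝒪`-linear through `DQ.toDual` for any pinned `Λ_𝒪`-structure on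
  `DQ.X` (forcing `IwasawaDual.IsLocNil.map_smul_eq_smulFun` + the LEAD's `map_smul_of_commute_C_iwasawaToIwasawaO`).
* ★ `exists_junction_linearMap`: `∃ j : B →ₗ[Λ_𝒪] LinearMap.ker (gXLinearMapO …)`, `DQ.toDual ∘ j = P` — the binder `j` of the LEAD's
  `lambdaInvariant_quotient_span_le_of_roadD_junction` (with `B := 𝐇¹_Σ(K^cyc_∞, T*)`), leaving exactly {`P`, reciprocity, annihilator identity, the two laws} as
  the Galois inputs of (J3).
References: [Kobayashi2003] Thm. 7.3 i); [Rubin2000] Thm. 1.7.3; [GreenbergLNM1716] §1; [Washington1997] §13.2.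
-/

set_option autoImplicit false
set_option linter.dupNamespace false -- D-0017: single-problem summit, the namespace repeats the problem name by design
noncomputable section

open scoped Classical
open NumberField IsDedekindDomain Field

universe u

namespace Summit.BirchSwinnertonDyer.BirchSwinnertonDyer.Theorems.SmallImageRttD2Seq

open Literature.NumberTheory.EllipticCurves Literature.NumberTheory.EllipticCurves.Kobayashi2003
  Literature.NumberTheory.EllipticCurves.GreenbergVatsal2000 Literature.NumberTheory.GaloisRepresentations
  Summit.BirchSwinnertonDyer.BirchSwinnertonDyer.Theorems.SmallImageCharSignedSelmer

/-! ## §12. THE JUNCTION SOCKET (Pontryagin side of row (J3)): `j : B → ker gX` from a pairing with reciprocity; onto by Poitou–Tate -/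

section JunctionSocket

variable {K : Type u} [Field K] [NumberField K] {p : ℕ} [Fact p.Prime] {κ : ZpExtension K p} {γ : absoluteGaloisGroup K}
  {M : Type u} [AddCommGroup M] [DistribMulAction (absoluteGaloisGroup K) M] [TopologicalSpace M] [DiscreteTopology M]
  {R : Type*} [Ring R] [Module R M]
  {V : WeierstrassCurve K} {j : V.geomPrimaryTorsion p →+ M} {S₀ : Set (HeightOneSpectrum (𝓞 K))} {ε : ℤˣ}
  (D : SignedTransportDualDataSat κ γ M R V j S₀ ε)
  {v : HeightOneSpectrum (𝓞 K)} [DistribMulAction (absoluteGaloisGroup (v.adicCompletion K)) M]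
  {γv : absoluteGaloisGroup (v.adicCompletion K)} (DQ : LocalCondDualData κ M R V j ε v γv)
  (hres : ∀ (σ : absoluteGaloisGroup (v.adicCompletion K)) (m : M), σ • m = resGalOfEmb (closureEmb (K := K) (v.adicCompletion K)) σ • m)
  (hvp : (p : 𝓞 K) ∈ v.asIdeal)
  {B : Type*} [AddCommGroup B] (P : B →+ (localCondInftySat κ M R V j ε v →+ AddCircle (1 : ℚ)))

/-- **The junction map `j : B → ker gX` from a pairing with RECIPROCITY.** Data: any abelian group `B` (intended: the compact global classes
`𝐇¹_Σ(K^cyc_∞, T*)`) with an additive `P : B → Hom(E^{ε}_{sat,v}, ℚ/ℤ)` (intended: `b ↦ ⟨loc_v b, ·⟩_v`, the local Tate pairing at the tower restricted to the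
local condition group) such that `P b` VANISHES on `loc_v(Sel)` for every `b` (reciprocity: the sum of the local invariants of a global cup product is zero and
the summands away from `v` vanish). Then `b ↦ DQ.toDual⁻¹ (P b)` lands in `ker gX` (`gXHom_eq_zero_iff`): there is `j : B →+ ker gX` with `DQ.toDual ∘ j = P`,
unique (`junctionHom_unique`). Row (J3) of the LEAD's INPUT SPEC (bus 16:25:56Z), Pontryagin side. [cite: Kobayashi2003, Thm. 7.3 i)] [cite: Washington1997, §13.2] -/
theorem exists_junctionHom (hrec : ∀ (b : B) (s : signedTransportSelmerInftySat κ M R V j S₀ ε), P b (locSat κ M R V j S₀ ε v hres hvp s) = 0) :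
    ∃ jn : B →+ (gXHom D DQ hres hvp).ker, ∀ b : B, DQ.toDual ((jn b : (gXHom D DQ hres hvp).ker) : DQ.X) = P b := by
  let e : DQ.X ≃+ (localCondInftySat κ M R V j ε v →+ AddCircle (1 : ℚ)) := AddEquiv.ofBijective DQ.toDual DQ.bijective
  have he : ∀ q, DQ.toDual (e.symm q) = q := fun q ↦ e.apply_symm_apply q
  refine ⟨((e.symm : _ →+ DQ.X).comp P).codRestrict (gXHom D DQ hres hvp).ker fun b ↦ ?_, fun b ↦ he (P b)⟩
  rw [AddMonoidHom.mem_ker, gXHom_eq_zero_iff]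
  intro s
  change DQ.toDual (e.symm (P b)) _ = 0
  rw [he]
  exact hrec b s

/-- The junction map is determined by `DQ.toDual ∘ j = P` (`DQ.toDual` is injective). [cite: Washington1997, §13.2] -/
theorem junctionHom_unique {j₁ j₂ : B →+ (gXHom D DQ hres hvp).ker}
    (h₁ : ∀ b : B, DQ.toDual ((j₁ b : (gXHom D DQ hres hvp).ker) : DQ.X) = P b)
    (h₂ : ∀ b : B, DQ.toDual ((j₂ b : (gXHom D DQ hres hvp).ker) : DQ.X) = P b) : j₁ = j₂ :=
  AddMonoidHom.ext fun b ↦ Subtype.ext (DQ.bijective.1 ((h₁ b).trans (h₂ b).symm))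

/-- **`j` is ONTO `ker gX` under the Poitou–Tate annihilator identity**: if every character of `E^{ε}_{sat,v}` vanishing on `loc_v(Sel)` is a `P b` (the
image of the global compact classes is the exact annihilator of `loc_v(Sel)` under local duality — Poitou–Tate, Rubin ES Thm. 1.7.3 = tree
`poitouTate_selmerStructure_duality` at finite level), then the junction map is surjective. [cite: Kobayashi2003, Thm. 7.3 i)] [cite: Rubin2000, Thm. 1.7.3] -/
theorem junctionHom_surjective_of_annihilator {jn : B →+ (gXHom D DQ hres hvp).ker}
    (hjn : ∀ b : B, DQ.toDual ((jn b : (gXHom D DQ hres hvp).ker) : DQ.X) = P b)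
    (hPT : ∀ q : localCondInftySat κ M R V j ε v →+ AddCircle (1 : ℚ),
      (∀ s : signedTransportSelmerInftySat κ M R V j S₀ ε, q (locSat κ M R V j S₀ ε v hres hvp s) = 0) → ∃ b : B, P b = q) :
    Function.Surjective jn := by
  rintro ⟨x, hx⟩
  obtain ⟨b, hb⟩ := hPT (DQ.toDual x) ((gXHom_eq_zero_iff D DQ hres hvp x).1 ((AddMonoidHom.mem_ker).1 hx))
  exact ⟨b, Subtype.ext (DQ.bijective.1 ((hjn b).trans hb))⟩

end JunctionSocket

section JunctionSocketO

variable {K : Type u} [Field K] [NumberField K] {p : ℕ} [Fact p.Prime] {κ : ZpExtension K p} {γ : absoluteGaloisGroup K}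
  (S : Set (PadicAlgCl p)) [FiniteDimensional ℚ_[p] (padicCoeffField S)]
  {M : Type u} [AddCommGroup M] [DistribMulAction (absoluteGaloisGroup K) M] [TopologicalSpace M] [DiscreteTopology M]
  [Module (padicCoeffIntegers S) M] [SMulCommClass (absoluteGaloisGroup K) (padicCoeffIntegers S) M]
  {V : WeierstrassCurve K} {j : V.geomPrimaryTorsion p →+ M} {S₀ : Set (HeightOneSpectrum (𝓞 K))} {ε : ℤˣ}
  (D : SignedTransportDualDataSat κ γ M (padicCoeffIntegers S) V j S₀ ε)
  {v : HeightOneSpectrum (𝓞 K)} [DistribMulAction (absoluteGaloisGroup (v.adicCompletion K)) M]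
  [SMulCommClass (absoluteGaloisGroup (v.adicCompletion K)) (padicCoeffIntegers S) M]
  {γv : absoluteGaloisGroup (v.adicCompletion K)} (DQ : LocalCondDualData κ M (padicCoeffIntegers S) V j ε v γv)
  (hres : ∀ (σ : absoluteGaloisGroup (v.adicCompletion K)) (m : M), σ • m = resGalOfEmb (closureEmb (K := K) (v.adicCompletion K)) σ • m)
  (hvp : (p : 𝓞 K) ∈ v.asIdeal)
  {B : Type*} [AddCommGroup B] [Module (IwasawaAlgebraO S) B] (P : B →+ (localCondInftySat κ M (padicCoeffIntegers S) V j ε v →+ AddCircle (1 : ℚ)))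

omit [FiniteDimensional ℚ_[p] (padicCoeffField S)] [DistribMulAction (absoluteGaloisGroup K) M]
  [SMulCommClass (absoluteGaloisGroup K) (padicCoeffIntegers S) M] in
/-- **Forcing on `B`**: if `P (T • b) = P b ∘ (conj_{γ_v} − 1)` and `P ((C a) • b) = P b ∘ (a ·)`, then along the restriction `Λ → Λ_𝒪` the pairing map takes the
`Λ`-action of `B` to the canonical finite-sum action `IsLocNil.smulFun` on `Hom(E^{ε}_{sat,v}, ℚ/ℤ)` (`IwasawaDual.IsLocNil.map_smul_eq_smulFun`; the constants of
`ℤ_p ⊂ 𝒪` act on `p^k`-torsion classes through `ℤ/p^k` by the LEAD's `scalarH1_padicInt_apply_of_pow_smul_eq_zero`). [cite: GreenbergLNM1716, §1 (after Conj. 1.3)] -/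
theorem pairing_map_iwasawaToIwasawaO_smul (htor : ∀ m : M, ∃ k : ℕ, p ^ k • m = 0)
    (hstab : ∀ m : M, IsOpen (MulAction.stabilizer (absoluteGaloisGroup (v.adicCompletion K)) m : Set (absoluteGaloisGroup (v.adicCompletion K))))
    (hv : AcSigned.IsNonsplitIn κ v) (hγv : κ.IsTopGenerator (resGalOfEmb (closureEmb (K := K) (v.adicCompletion K)) γv))
    (hPX : ∀ (b : B) (c : localCondInftySat κ M (padicCoeffIntegers S) V j ε v),
      P ((PowerSeries.X : IwasawaAlgebraO S) • b) c = P b ((conjLocalSat κ M (padicCoeffIntegers S) V j ε v γv - 1) c))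
    (hPC : ∀ (a : padicCoeffIntegers S) (b : B) (c : localCondInftySat κ M (padicCoeffIntegers S) V j ε v),
      P ((PowerSeries.C a : IwasawaAlgebraO S) • b) c = P b (scalarLocalSat κ M (padicCoeffIntegers S) V j ε v a c))
    (r : IwasawaAlgebra p) (b : B) :
    P (iwasawaToIwasawaO S r • b) = (isLocNil_conjLocalSat_sub_one κ M (padicCoeffIntegers S) V j ε v htor hstab hv hγv).smulFun r (P b) := by
  letI instΛB : Module (IwasawaAlgebra p) B := Module.compHom B (iwasawaToIwasawaO S)
  exact (isLocNil_conjLocalSat_sub_one κ M (padicCoeffIntegers S) V j ε v htor hstab hv hγv).map_smul_eq_smulFun (X' := B) P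
    (fun b c ↦ by
      change P ((iwasawaToIwasawaO S PowerSeries.X) • b) c = P b _
      rw [iwasawaToIwasawaO, PowerSeries.map_X, hPX])
    (fun c b s k hk ↦ by
      change P ((iwasawaToIwasawaO S (PowerSeries.C c)) • b) s = (PadicInt.toZModPow k c).val • P b s
      rw [iwasawaToIwasawaO, PowerSeries.map_C, hPC, ← map_nsmul]
      congr 1
      refine Subtype.ext ?_
      rw [coe_scalarLocalSat_apply, AddSubgroupClass.coe_nsmul]
      have hks : p ^ k • (s : subgroupH1 (localSubgroupOfEmb κ.kerSubgroup (closureEmb (K := K) (v.adicCompletion K))) M) = 0 := by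
        rw [← AddSubgroupClass.coe_nsmul, hk, ZeroMemClass.coe_zero]
      exact scalarH1_padicInt_apply_of_pow_smul_eq_zero _ M (padicIntToCoeffIntegers S) c hks)
    r b

omit [DistribMulAction (absoluteGaloisGroup K) M] [SMulCommClass (absoluteGaloisGroup K) (padicCoeffIntegers S) M] in
/-- **The pairing map is "`Λ_𝒪`-linear through `DQ.toDual`"**: under the two intertwining laws (`γ_v`-equivariance in the dual convention of `LocalCondDualData`,
`𝒪`-bilinearity), for every `F ∈ Λ_𝒪` and any pinned `Λ_𝒪`-structure `instQ` on `DQ.X`: `P (F • b) = DQ.toDual (F • DQ.toDual⁻¹ (P b))` (forcing on both sides +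
the LEAD's `map_smul_of_commute_C_iwasawaToIwasawaO`). [cite: GreenbergLNM1716, §1 (after Conj. 1.3)] [folklore] -/
theorem pairing_map_smul_eq (instQ : Module (IwasawaAlgebraO S) DQ.X)
    (hιQ : ∀ (f : IwasawaAlgebra p) (x : DQ.X), (letI := instQ; iwasawaToIwasawaO S f • x) = f • x)
    (hCQ : ∀ (a : padicCoeffIntegers S) (x : DQ.X) (c : localCondInftySat κ M (padicCoeffIntegers S) V j ε v),
      DQ.toDual (letI := instQ; (PowerSeries.C a : IwasawaAlgebraO S) • x) c = DQ.toDual x (scalarLocalSat κ M (padicCoeffIntegers S) V j ε v a c))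
    (htor : ∀ m : M, ∃ k : ℕ, p ^ k • m = 0)
    (hstab : ∀ m : M, IsOpen (MulAction.stabilizer (absoluteGaloisGroup (v.adicCompletion K)) m : Set (absoluteGaloisGroup (v.adicCompletion K))))
    (hv : AcSigned.IsNonsplitIn κ v) (hγv : κ.IsTopGenerator (resGalOfEmb (closureEmb (K := K) (v.adicCompletion K)) γv))
    (hPX : ∀ (b : B) (c : localCondInftySat κ M (padicCoeffIntegers S) V j ε v),
      P ((PowerSeries.X : IwasawaAlgebraO S) • b) c = P b ((conjLocalSat κ M (padicCoeffIntegers S) V j ε v γv - 1) c))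
    (hPC : ∀ (a : padicCoeffIntegers S) (b : B) (c : localCondInftySat κ M (padicCoeffIntegers S) V j ε v),
      P ((PowerSeries.C a : IwasawaAlgebraO S) • b) c = P b (scalarLocalSat κ M (padicCoeffIntegers S) V j ε v a c))
    (F : IwasawaAlgebraO S) (b : B) :
    P (F • b) = DQ.toDual (letI := instQ; F • (AddEquiv.ofBijective DQ.toDual DQ.bijective).symm (P b)) := by
  letI := instQ
  let Φ : B →+ DQ.X := ((AddEquiv.ofBijective DQ.toDual DQ.bijective).symm : _ →+ DQ.X).comp P
  have hΦ : ∀ b, DQ.toDual (Φ b) = P b := fun b ↦ (AddEquiv.ofBijective DQ.toDual DQ.bijective).apply_symm_apply (P b)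
  have key : Φ (F • b) = F • Φ b :=
    SmallImageRttCharRoad.map_smul_of_commute_C_iwasawaToIwasawaO S Φ
      (fun r b ↦ DQ.bijective.1 (by
        rw [hΦ, hιQ, DQ.toDual_smul_eq_smulFun htor hstab hv hγv, hΦ]
        exact pairing_map_iwasawaToIwasawaO_smul S P htor hstab hv hγv hPX hPC r b))
      (fun a b ↦ DQ.bijective.1 (by ext c; rw [hΦ, hPC, hCQ, hΦ])) F b
  calc P (F • b) = DQ.toDual (Φ (F • b)) := (hΦ _).symm
    _ = DQ.toDual (F • Φ b) := by rw [key]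

/-- ★ **THE JUNCTION MAP AS A `Λ_𝒪`-LINEAR MAP `j : B →ₗ[Λ_𝒪] ker gX`** (row (J3) of the LEAD's INPUT SPEC, Pontryagin side): from a pairing-induced additive
`P : B → Hom(E^{ε}_{sat,v}, ℚ/ℤ)` with RECIPROCITY (`P b` kills `loc_v(Sel)`) and the two intertwining laws (`γ_v`-equivariance in the dual convention, `𝒪`-bilinearity),
for the pinned `Λ_𝒪`-structures `instX`/`instQ`: there is a `Λ_𝒪`-linear `j : B → ker gX` (`gX = gXLinearMapO`) with `DQ.toDual ∘ j = P`; it is unique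
(`junctionHom_unique`) and ONTO under the Poitou–Tate annihilator identity (`junctionHom_surjective_of_annihilator`). With `B := 𝐇¹_Σ(K^cyc_∞, T*)`, `s := sp¹`, `ζ̄`,
this is the binder `j` of the LEAD's `lambdaInvariant_quotient_span_le_of_roadD_junction`; `hmeet` is free (`Q` torsion-free). [cite: Kobayashi2003, Thm. 7.3 i)]
[cite: GreenbergLNM1716, §1 (after Conj. 1.3)] [cite: Washington1997, §13.2] -/
theorem exists_junction_linearMap (instX : Module (IwasawaAlgebraO S) D.X) (instQ : Module (IwasawaAlgebraO S) DQ.X)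
    (hιX : ∀ (f : IwasawaAlgebra p) (x : D.X), (letI := instX; iwasawaToIwasawaO S f • x) = f • x)
    (hιQ : ∀ (f : IwasawaAlgebra p) (x : DQ.X), (letI := instQ; iwasawaToIwasawaO S f • x) = f • x)
    (hCX : ∀ (a : padicCoeffIntegers S) (x : D.X) (s : signedTransportSelmerInftySat κ M (padicCoeffIntegers S) V j S₀ ε),
      D.toDual (letI := instX; (PowerSeries.C a : IwasawaAlgebraO S) • x) s =
        D.toDual x ⟨GreenbergSelmer.scalarH1 κ.kerSubgroup M a s, scalarH1_mem_signedTransportSelmerInftySat κ M (padicCoeffIntegers S) V j S₀ ε a s.2⟩)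
    (hCQ : ∀ (a : padicCoeffIntegers S) (x : DQ.X) (c : localCondInftySat κ M (padicCoeffIntegers S) V j ε v),
      DQ.toDual (letI := instQ; (PowerSeries.C a : IwasawaAlgebraO S) • x) c = DQ.toDual x (scalarLocalSat κ M (padicCoeffIntegers S) V j ε v a c))
    (htor : ∀ m : M, ∃ k : ℕ, p ^ k • m = 0)
    (hstabK : ∀ m : M, IsOpen (MulAction.stabilizer (absoluteGaloisGroup K) m : Set (absoluteGaloisGroup K)))
    (hstab : ∀ m : M, IsOpen (MulAction.stabilizer (absoluteGaloisGroup (v.adicCompletion K)) m : Set (absoluteGaloisGroup (v.adicCompletion K))))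
    (hγ : κ.IsTopGenerator γ) (hv : AcSigned.IsNonsplitIn κ v) (hγv : κ.IsTopGenerator (resGalOfEmb (closureEmb (K := K) (v.adicCompletion K)) γv))
    (hrec : ∀ (b : B) (s : signedTransportSelmerInftySat κ M (padicCoeffIntegers S) V j S₀ ε),
      P b (locSat κ M (padicCoeffIntegers S) V j S₀ ε v hres hvp s) = 0)
    (hPX : ∀ (b : B) (c : localCondInftySat κ M (padicCoeffIntegers S) V j ε v),
      P ((PowerSeries.X : IwasawaAlgebraO S) • b) c = P b ((conjLocalSat κ M (padicCoeffIntegers S) V j ε v γv - 1) c))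
    (hPC : ∀ (a : padicCoeffIntegers S) (b : B) (c : localCondInftySat κ M (padicCoeffIntegers S) V j ε v),
      P ((PowerSeries.C a : IwasawaAlgebraO S) • b) c = P b (scalarLocalSat κ M (padicCoeffIntegers S) V j ε v a c)) :
    letI := instX; letI := instQ
    ∃ jn : B →ₗ[IwasawaAlgebraO S] LinearMap.ker (gXLinearMapO S D DQ hres hvp instX instQ hιX hιQ hCX hCQ htor hstabK hstab hγ hv hγv),
      ∀ b : B, DQ.toDual ((jn b : LinearMap.ker (gXLinearMapO S D DQ hres hvp instX instQ hιX hιQ hCX hCQ htor hstabK hstab hγ hv hγv)) : DQ.X) = P b := by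
  letI := instX; letI := instQ
  let e : DQ.X ≃+ (localCondInftySat κ M (padicCoeffIntegers S) V j ε v →+ AddCircle (1 : ℚ)) := AddEquiv.ofBijective DQ.toDual DQ.bijective
  have he : ∀ q, DQ.toDual (e.symm q) = q := fun q ↦ e.apply_symm_apply q
  -- the `Λ_𝒪`-linear map `B → DQ.X`, `b ↦ e.symm (P b)`
  let Φ : B →ₗ[IwasawaAlgebraO S] DQ.X :=
    { toFun := fun b ↦ e.symm (P b)
      map_add' := fun b b' ↦ by rw [map_add, map_add]
      map_smul' := fun F b ↦ by
        apply DQ.bijective.1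
        rw [he, RingHom.id_apply, pairing_map_smul_eq S DQ P instQ hιQ hCQ htor hstab hv hγv hPX hPC F b] }
  have hΦ : ∀ b, DQ.toDual (Φ b) = P b := fun b ↦ he (P b)
  refine ⟨LinearMap.codRestrict _ Φ fun b ↦ ?_, fun b ↦ hΦ b⟩
  rw [LinearMap.mem_ker, gXLinearMapO_apply, gXHom_eq_zero_iff]
  intro s
  rw [hΦ]
  exact hrec b s

end JunctionSocketO

end Summit.BirchSwinnertonDyer.BirchSwinnertonDyer.Theorems.SmallImageRttD2Seq

end
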